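import Literature.AlgebraicGeometry.Frobenioids.FiberProductsMorphisms
import HarnessLib

/-!
# Frobenioids I, Proposition 1.6 (ii): lifting squares in `C ×_D D′` (STEP-0 calibration fragment
# of the abc-iut cell — "routine verification" genre)

Mochizuki, *The geometry of Frobenioids I: the general theory*, Kyushu J. Math. **62** (2008)
293–400, §1, Proposition 1.6 (ii) and the last sentence of its proof, kurims text p. 28
[cite: MochizukiFrdI2008, Prop. 1.6]:

Bookkeeping for the "routine verification" that `C′ = C ×_D D′` is a Frobenioid
(`FiberProductsFrobenioid.lean`): lifting commutative squares along a common source or target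
(`w_of_comp`, `liftCod`, `w_of_comp_right`, `liftDom`), restriction of lifts (`liftRest`), and the
computation of `(ψ^*)⁻¹ Div ψ` in `C′` (`invDiv_eq`). No statement of the paper is strengthened.
-/

namespace Literature.AlgebraicGeometry.Frobenioids

open CategoryTheory Opposite

universe w v v' v'' u u' u''

namespace PreFrobenioid

variable {D : Type u} [Category.{v} D] {D' : Type u'} [Category.{v'} D']
  {Φ : Dᵒᵖ ⥤ CommMonCat.{w}} {C : Type u''} [Category.{v''} C]
  {F : C ⥤ ElemFrobenioid Φ} {G : D' ⥤ D}

namespace FiberProduct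

/-! ### Lifting squares along a common source or a common target -/

/-- For `φ : X → Y`, `φ′ : X → Y′` in `C′` with `φ′_D′`... : if `f₀ : Y_C → Y′_C` satisfies
`f₀ ∘ φ_C = φ′_C`, then `(f₀, φ′_{D′} ∘ φ_{D′}⁻¹)` is compatible with the identifications
(`D` totally epimorphic). [cite: MochizukiFrdI2008, Prop. 1.6] -/
theorem w_of_comp (hD : IsTotallyEpimorphic D) {X Y Y' : FiberProduct F G} (φ : X ⟶ Y) (φ' : X ⟶ Y')
    [IsIso φ.snd] (f₀ : Y.fst ⟶ Y'.fst) (h : φ.fst ≫ f₀ = φ'.fst) :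
    Base F f₀ ≫ Y'.e.hom = Y.e.hom ≫ G.map (inv φ.snd ≫ φ'.snd) := by
  haveI := hD.epi (Base F φ.fst)
  rw [← cancel_epi (Base F φ.fst)]
  calc Base F φ.fst ≫ Base F f₀ ≫ Y'.e.hom
      = Base F φ'.fst ≫ Y'.e.hom := by rw [← Category.assoc, ← base_comp, h]
    _ = X.e.hom ≫ G.map φ'.snd := hom_w φ'
    _ = X.e.hom ≫ G.map φ.snd ≫ G.map (inv φ.snd ≫ φ'.snd) := by
        rw [G.map_comp, Functor.map_inv, IsIso.hom_inv_id_assoc]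
    _ = Base F φ.fst ≫ Y.e.hom ≫ G.map (inv φ.snd ≫ φ'.snd) := by
        rw [← Category.assoc, ← hom_w φ, Category.assoc]

/-- The arrow `Y → Y′` of `C′` obtained from `w_of_comp`. [cite: MochizukiFrdI2008, Prop. 1.6] -/
noncomputable def liftCod (hD : IsTotallyEpimorphic D) {X Y Y' : FiberProduct F G} (φ : X ⟶ Y)
    (φ' : X ⟶ Y') [IsIso φ.snd] (f₀ : Y.fst ⟶ Y'.fst) (h : φ.fst ≫ f₀ = φ'.fst) : Y ⟶ Y' :=
  ⟨f₀, inv φ.snd ≫ φ'.snd, w_of_comp hD φ φ' f₀ h⟩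

/-- `liftCod ∘ φ = φ′`. [cite: MochizukiFrdI2008, Prop. 1.6] -/
theorem comp_liftCod (hD : IsTotallyEpimorphic D) {X Y Y' : FiberProduct F G} (φ : X ⟶ Y)
    (φ' : X ⟶ Y') [IsIso φ.snd] (f₀ : Y.fst ⟶ Y'.fst) (h : φ.fst ≫ f₀ = φ'.fst) :
    φ ≫ liftCod hD φ φ' f₀ h = φ' :=
  CFP.hom_ext h (by
    show φ.snd ≫ inv φ.snd ≫ φ'.snd = φ'.snd
    rw [IsIso.hom_inv_id_assoc])

/-- For `ψ : Y → X`, `ψ′ : Y′ → X` in `C′` with `ψ′_{D′}` invertible: if `g₀ : Y_C → Y′_C` satisfies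
`ψ′_C ∘ g₀ = ψ_C`, then `(g₀, ψ′_{D′}⁻¹ ∘ ψ_{D′})` is compatible with the identifications.
[cite: MochizukiFrdI2008, Prop. 1.6] -/
theorem w_of_comp_right {X Y Y' : FiberProduct F G} (ψ : Y ⟶ X) (ψ' : Y' ⟶ X) [IsIso ψ'.snd]
    (g₀ : Y.fst ⟶ Y'.fst) (h : g₀ ≫ ψ'.fst = ψ.fst) :
    Base F g₀ ≫ Y'.e.hom = Y.e.hom ≫ G.map (ψ.snd ≫ inv ψ'.snd) := by
  rw [← cancel_mono (G.map ψ'.snd)]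
  calc (Base F g₀ ≫ Y'.e.hom) ≫ G.map ψ'.snd
      = Base F g₀ ≫ Base F ψ'.fst ≫ X.e.hom := by rw [Category.assoc, hom_w ψ']
    _ = Base F ψ.fst ≫ X.e.hom := by rw [← Category.assoc, ← base_comp, h]
    _ = Y.e.hom ≫ G.map ψ.snd := hom_w ψ
    _ = (Y.e.hom ≫ G.map (ψ.snd ≫ inv ψ'.snd)) ≫ G.map ψ'.snd := by
        rw [Category.assoc, ← G.map_comp, Category.assoc, IsIso.inv_hom_id, Category.comp_id]

/-- The arrow `Y → Y′` of `C′` obtained from `w_of_comp_right`. [cite: MochizukiFrdI2008, Prop. 1.6] -/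
noncomputable def liftDom {X Y Y' : FiberProduct F G} (ψ : Y ⟶ X) (ψ' : Y' ⟶ X) [IsIso ψ'.snd]
    (g₀ : Y.fst ⟶ Y'.fst) (h : g₀ ≫ ψ'.fst = ψ.fst) : Y ⟶ Y' :=
  ⟨g₀, ψ.snd ≫ inv ψ'.snd, w_of_comp_right ψ ψ' g₀ h⟩

/-- `ψ′ ∘ liftDom = ψ`. [cite: MochizukiFrdI2008, Prop. 1.6] -/
theorem liftDom_comp {X Y Y' : FiberProduct F G} (ψ : Y ⟶ X) (ψ' : Y' ⟶ X) [IsIso ψ'.snd]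
    (g₀ : Y.fst ⟶ Y'.fst) (h : g₀ ≫ ψ'.fst = ψ.fst) : liftDom ψ ψ' g₀ h ≫ ψ' = ψ :=
  CFP.hom_ext h (by
    show (ψ.snd ≫ inv ψ'.snd) ≫ ψ'.snd = ψ.snd
    rw [Category.assoc, IsIso.inv_hom_id, Category.comp_id])

/-- For `φ : X → Y` in `C′` and a factorisation `φ_C = r ∘ g` with `g_D` invertible: the arrow
`(r, φ_{D′}) : (B, X′, α ∘ g_D⁻¹) → Y`. [cite: MochizukiFrdI2008, Prop. 1.6] -/
noncomputable def liftRest {X Y : FiberProduct F G} (φ : X ⟶ Y) {B : C} (g : X.fst ⟶ B)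
    (hg : IsIso (Base F g)) (r : B ⟶ Y.fst) (h : g ≫ r = φ.fst) : liftTgt X g hg ⟶ Y :=
  haveI := hg
  ⟨r, φ.snd, by
    show Base F r ≫ Y.e.hom = (inv (Base F g) ≫ X.e.hom) ≫ G.map φ.snd
    rw [Category.assoc, ← hom_w φ, ← h, base_comp, Category.assoc, IsIso.inv_hom_id_assoc]⟩

/-- `liftRest ∘ (g, id) = φ`. [cite: MochizukiFrdI2008, Prop. 1.6] -/
theorem liftTgtHom_comp_liftRest {X Y : FiberProduct F G} (φ : X ⟶ Y) {B : C} (g : X.fst ⟶ B)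
    (hg : IsIso (Base F g)) (r : B ⟶ Y.fst) (h : g ≫ r = φ.fst) :
    liftTgtHom X g hg ≫ liftRest φ g hg r h = φ :=
  CFP.hom_ext h (Category.id_comp _)

/-- Base-equivalent arrows of `C′` have base-equivalent `C`-components. [cite: MochizukiFrdI2008, Prop. 1.6] -/
theorem base_fst_eq_of_snd_eq {X Y : FiberProduct F G} {φ ψ : X ⟶ Y} (h : φ.snd = ψ.snd) :
    Base F φ.fst = Base F ψ.fst := by
  rw [← cancel_mono Y.e.hom, hom_w φ, hom_w ψ, h]

/-- `(ψ^*)⁻¹(Div ψ)` computed in `C′` is `(α⁻¹)^*` of the same quantity computed in `C`.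
[cite: MochizukiFrdI2008, Prop. 1.6] -/
theorem invDiv_eq {Y X : FiberProduct F G} (ψ : Y ⟶ X) (h : IsBaseIso (fiberProductFunctor F G) ψ) :
    haveI : IsIso ψ.snd := h
    invDiv (fiberProductFunctor F G) ψ h =
      pull Φ X.e.inv (invDiv F ψ.fst (isBaseIso_fst_of_isIso_snd ψ)) := by
  haveI : IsIso ψ.snd := h
  haveI : IsIso (Base F ψ.fst) := isBaseIso_fst_of_isIso_snd ψ
  have key : G.map (inv ψ.snd) ≫ Y.e.inv = X.e.inv ≫ inv (Base F ψ.fst) := by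
    rw [← cancel_mono (Base F ψ.fst), Category.assoc, Category.assoc, IsIso.inv_hom_id,
      Category.comp_id, inv_comp_base, ← Category.assoc, ← G.map_comp, IsIso.inv_hom_id, G.map_id,
      Category.id_comp]
  show pull Φ (G.map (inv ψ.snd)) (pull Φ Y.e.inv (Div F ψ.fst)) =
    pull Φ X.e.inv (pull Φ (inv (Base F ψ.fst)) (Div F ψ.fst))
  rw [← pull_comp, ← pull_comp, key]

end FiberProduct

end PreFrobenioid

end Literature.AlgebraicGeometry.Frobenioids
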